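import Literature.NumberTheory.Automorphic.UpqInfUnitaryFactorialBound        -- ★ p835016 (A-p06 (g24)): FB head `upq_factorialBound_of_isIrreducibleGK`
import Literature.NumberTheory.Automorphic.InfUnitaryHilbertCompletionKAction  -- ★ (A-p14 (g24)): `InfUnitary.form`, `isPosDefHerm_form`, `form_skew`, `form_inv`
import Literature.NumberTheory.Automorphic.GKModulesDixmierSchur                 -- ★ p830646 (A-p06 (g24)): N0 `upqCasimirOp_eq_algebraMap_of_isIrreducibleGK`
import HarnessLib

/-!
# (FB) for an irreducible infinitesimally unitary `(𝔤, K)`-module of `U(α, β)` — all hypotheses discharged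

Topic `NumberTheory/Automorphic`; namespace `Literature.NumberTheory.Automorphic`; THEOREMS ONLY (no `def`, no named fact, no instance declaration, no notation,
no `sorry`).  Cell `hodgecm-mathlib`, F0∕P3, T1a arch line, ROAD-GLOB (A6 #92 at `U(2,1)`; A-p14 (g24) v1 + LEAD F0P3b-p01 (g3) v1.1 §1(a)): the factorial bound
(FB) READY TO CITE for `r : GKIrrep (uFormGroup α β)` with `hu : IsInfUnitary r.ρK r.ρ𝔤` — the form is the CHOSEN one of ★ `InfUnitary.form hu` (so `ι = emb` is G0's
completion map for that form), the Casimir scalar comes from Dixmier ★ N0 (no admissibility), and the generating `K`-type is the span of the `K`-orbit of any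
non-zero vector (★ `IsGKModule.kFinite`): **`InfUnitary.factorialBound`** —
`∃ K ≥ 0, ∀ v, ∃ C, ∀ m (X : Fin m → 𝔤), ‖emb (ρ𝔤 X₀ ⋯ ρ𝔤 X_{m−1} v)‖ ≤ C · m! · K^m · ∏ ‖X_i‖` (`L^∞`-operator norm on `𝔤`).
[HarishChandra1953, §9]; [Nelson1959, §2]; [KnappVogan1995, Thm. 0.6].
HONEST LABEL: closes no registered stub by itself (it is the input (FB) of P1∕P2∕P3∕Φ of the road).  HC_CM is proved only modulo the 2 remaining named inputs
(hLiu418, h413) until rung 0 closes.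

## References
* Harish-Chandra, *Representations of a semisimple Lie group on a Banach space. I*, Trans. AMS 75 (1953), §9 [HarishChandra1953].
* E. Nelson, *Analytic vectors*, Ann. of Math. 70 (1959), §2 [Nelson1959].
* A. W. Knapp, D. A. Vogan, *Cohomological Induction and Unitary Representations* (1995), Thm. 0.6 [KnappVogan1995].
-/

-- Mathlib idiom (as in ★ `GKModules`): the commutator bracket on `Module.End ℂ V`, to MENTION `ρ𝔤 : 𝔤 →ₗ⁅ℝ⁆ End V`.
attribute [local instance 100] LieRing.ofAssociativeRing

set_option autoImplicit false

noncomputable section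

namespace Literature.NumberTheory.Automorphic

open scoped Matrix Matrix.Norms.Operator
open Literature.RepresentationTheory Literature.RepresentationTheory.KonnoKonno2007 Literature.RepresentationTheory.KonnoKonno2007.RealDualPair
open Literature.RepresentationTheory.BorelWallach2000

variable {α β : Type} [Fintype α] [DecidableEq α] [Fintype β] [DecidableEq β]

/-- **A generating `K`-type**: in an irreducible `(𝔤, K)`-module there is a finite-dimensional `K`-stable `W₀ ≠ ⊥` (the span of the `K`-orbit of a non-zero
vector; ★ `IsGKModule.kFinite`, ★ `GKTensor.kOrbitSpan_stable`). [cite: KnappVogan1995, Thm. 0.6] -/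
theorem exists_finiteDimensional_kStable_ne_bot (r : GKIrrep (uFormGroup α β)) :
    ∃ W₀ : Submodule ℂ r.V, FiniteDimensional ℂ W₀ ∧ (∀ (k : (uFormGroup α β).maximalCompact), ∀ w ∈ W₀, r.ρK k w ∈ W₀) ∧ W₀ ≠ ⊥ := by
  haveI := r.isIrreducible.nontrivial
  obtain ⟨v, hv⟩ := exists_ne (0 : r.V)
  refine ⟨Submodule.span ℂ (Set.range fun k : (uFormGroup α β).maximalCompact => r.ρK k v), r.isGKModule.kFinite v,
    fun k w hw => GKTensor.kOrbitSpan_stable (uFormGroup α β) r.ρK v k hw, fun h => hv ?_⟩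
  exact (Submodule.eq_bot_iff _).mp h v (IsGKModule.mem_span_orbit_self v)

/-- **(FB) FOR AN IRREDUCIBLE INFINITESIMALLY UNITARY `(𝔤, K)`-MODULE OF `U(α, β)`** — with the chosen form of ★ `InfUnitary.form hu` and its completion map
`emb` (★ G0): `∃ K ≥ 0, ∀ v, ∃ C, ∀ m (X : Fin m → 𝔤), ‖emb (ρ𝔤 X₀ ⋯ ρ𝔤 X_{m−1} v)‖ ≤ C · m! · K^m · ∏ ‖X_i‖`.
[cite: HarishChandra1953, §9] [cite: Nelson1959, §2] [cite: KnappVogan1995, Thm. 0.6] -/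
theorem InfUnitary.factorialBound [Nonempty α] [Nonempty β] (r : GKIrrep (uFormGroup α β)) (hu : Liu2021.LemD2.IsInfUnitary r.ρK r.ρ𝔤) :
    ∃ K : ℝ, 0 ≤ K ∧ ∀ v : r.V, ∃ C : ℝ, ∀ (m : ℕ) (X : Fin m → (uFormGroup α β).lie),
      ‖(InfUnitary.isPosDefHerm_form hu).emb ((List.ofFn fun i => r.ρ𝔤 (X i)).prod v)‖ ≤
        C * m.factorial * K ^ m * ∏ i, ‖((X i : (uFormGroup α β).lie) : Matrix (α ⊕ β) (α ⊕ β) ℂ)‖ := by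
  -- the Casimir is a scalar (Dixmier, ★ N0)
  obtain ⟨c, hc⟩ := upqCasimirOp_eq_algebraMap_of_isIrreducibleGK r.isGKModule r.isIrreducible
  have hc' : ∀ v : r.V, upqCasimirOp r.ρ𝔤 v = c • v := fun v => by rw [hc, Module.algebraMap_end_apply]
  -- a generating `K`-type
  obtain ⟨W₀, hfd, hW₀K, hW₀ne⟩ := exists_finiteDimensional_kStable_ne_bot r
  haveI := hfd
  exact upq_factorialBound_of_isIrreducibleGK r.ρK r.ρ𝔤 r.isGKModule r.isIrreducible (InfUnitary.isPosDefHerm_form hu)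
    (InfUnitary.form_skew hu) (InfUnitary.form_inv hu) hc' W₀ hW₀K hW₀ne

end Literature.NumberTheory.Automorphic

end
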